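import Summits.QuantumFields.BalabanUV.Beta.FP.MaxwellSymbolDerivOn
import Summits.QuantumFields.BalabanUV.Beta.FP.PerfectSymbol166RealLineRe

/-!
# `BalabanUV.Beta.FP.PerfectSymbolDeriv` — road «FP» for binder row D1, leaf H2-P of the horizontal route, row H2-P-REG (owner ruling R-FP-17), R2 = THE
# INSTANCE: the entries of the EXCESS `maxwellMat (Re W_∞ − 1) p̂` and of the Feynman-completed perfect symbol `feynMat (Re W_∞) p̂` (the matrix inverted by
# `PinfSym`) are `C³` along every coordinate slice of the real Brillouin zone and GRADED OF ORDER 4 ∕ 2: `‖∂ᵢⁿ R(s)‖ ≤ KR·‖s‖^{4−n}`, `‖∂ᵢⁿ A(s)‖ ≤ KA·‖s‖^{2−n}`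

HONEST DEPENDENCY (page 1, mandatory): continuum YM on T⁴ ⇐ BetaPertH ∧ nine spine estimates (0/9 proved); BetaPertH ⇐ (D1) ∧ (D4) ∧ CAP+tail;
G-an2-4 gates asym, D1 and NE2/3/4.  HONEST FRAMING (cell contract, verbatim): «discharging `BetaPertH` makes Bałaban's UV stability UNCONDITIONAL —
a real constructive-QFT result; it is NOT the continuum limit and NOT the Clay problem.»  THIS MODULE DISCHARGES NOTHING of the wall: it DISCHARGES the weight
hypotheses of R1′ (`FP/MaxwellSymbolDerivOn`) for `w := Re W_∞` from tree theorems BY NAME — W166-FLAT (`PerfectSymbol166Flat.abs_re_W166Inf_ofReal_sub_one_le`,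
order 0) and W166-HOLO (D)∕(E) (`PerfectSymbol166RealLineRe.hasDerivAt_reDW_update`, `abs_reDW_le`, `abs_reDW_one_le_mul_abs_apply`; d1-formalise-leaf-01 g8,
orders 1–3, non-explicit Cauchy constants `bound166`, `delta166`).  Three explicit real CONSTANTS (`cwP`, `KRP`, `KAP`, [our object]); no `def … : Prop`;
nothing cited; 0 sorry; NOT D1, NOT BetaPertH, NOT continuum, NOT Clay.

ABSOLUTE RULE (cell charter, verbatim): «No internally-minted statement may enter as a cited fact. Every hypothesis is either kernel-proved in this package or a
verbatim quotation of a PUBLISHED theorem with page reference. The manuscript(s) under audit are NOT citable for their own disputed steps — they are the thing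
under adjudication; programme-internal (2001/route/tribunal) claims are never citable.»

WHAT (lattice dimension `d + 1`; `s ∈ BZ (d+1)`; direction `i`; `δ := delta166 (d+1)`, `B := bound166 (d+1)`; the OPEN interval `U := Ioo (−(π+δ)) (π+δ) ∋ s i`).
* §1 the real slice `t ↦ Re W_∞(μ,ν; ofRealVec (update s i t))` (= `reDW 0 μ ν i (update s i t)`) is `ContDiffOn ℝ 3 · U` (`contDiffOn_reW_slice`, from the
  `HasDerivAt` chain `reDW j → reDW (j+1)` on `U` via `contDiffOn_succ_iff_deriv_of_isOpen` thrice), and so is its complex cast; its real-parameter derivatives at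
  `s i` ARE `reDW n μ ν i s` (`iteratedDeriv_reW_slice`, uniqueness of derivatives near `s i`, `Filter.EventuallyEq.iteratedDeriv_eq`).
* §2 THE GRADED WEIGHT HYPOTHESIS DISCHARGED: `‖iteratedDeriv n (t ↦ ((Re W_∞(update s i t) : ℝ) : ℂ) − 1) (s i)‖ ≤ cwP d · ‖s‖^{2−n}`, `n ≤ 3`
  (`graded_reW_slice`): `n = 0` W166-FLAT (`CW·Σ S1r ≤ CW·(d+1)·‖s‖²`), `n = 1` `abs_reDW_one_le_mul_abs_apply` (`|s i| ≤ ‖s‖`), `n = 2, 3` `abs_reDW_le`;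
  `cwP d := CW (d+1)·(d+1) + 2B∕(δ∕2)² + 2B∕(δ∕2)² + 6B∕(δ∕2)³`.
* §3 **`graded_perfect_excess_entry`**: `‖∂ᵢⁿ [maxwellMat (Re W_∞ − 1) (p̂)]_{γβ}(s)‖ ≤ KRP d · ‖s‖^{4−n}` and **`graded_perfect_feyn_entry`**:
  `‖∂ᵢⁿ [feynMat (Re W_∞) (p̂)]_{γβ}(s)‖ ≤ KAP d · ‖s‖^{2−n}`, `n ≤ 3`, for EVERY `s ∈ BZ (d+1)`, `i γ β` (`M := π + 1`), with `ContDiffOn ℝ 3 · U` of both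
  slices and the `HasDerivAt` chain on `U` (`hasDerivAt_perfect_*_chain`) — the `A`-letters of H2-P-INV (gan24-formalise-leaf-01) and the `R`-letters of
  H2-P-B (gan24-formalise-leaf-05) for the ACTUAL perfect symbol.
Provenance: binder row G-an2-4 owner lineage gan24-p3, gen 16 (prover-b2b-balaban-gan24-p3-g16-0), 2026-08-20; row H2-P-REG (owner b2b-balaban-beta-d1-p3).
-/

noncomputable section

namespace Summit.QuantumFields.BalabanUV.Beta.FP.PerfectSymbolDeriv

open Complex Finset Set Filter
open scoped BigOperators ComplexConjugate Topology
open Literature.MathematicalPhysics.QuantumFieldTheory.Balaban1983to89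
open B4Strip (ofRealVec S1r)
open B4ContourShift (BZ)
open B5Prop11Fiber (d1Sym)
open Summit.QuantumFields.BalabanUV.Beta.FP.PerfectSymbol166 (W166Inf)
open Summit.QuantumFields.BalabanUV.Beta.FP.PerfectPropagatorSymbol (curlRow maxwellMat feynMat)
open Summit.QuantumFields.BalabanUV.Beta.FP.PerfectSymbol166FlatFactors (sq_le_S1r)
open Summit.QuantumFields.BalabanUV.Beta.FP.PerfectSymbol166Flat (CW CW_nonneg abs_re_W166Inf_ofReal_sub_one_le)
open Summit.QuantumFields.BalabanUV.Beta.FP.PerfectSymbol166StripReg (delta166 delta166_pos bound166 bound166_nonneg)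
open Summit.QuantumFields.BalabanUV.Beta.FP.PerfectSymbol166RealLineRe (reDW reDW_zero hasDerivAt_reDW_update abs_reDW_le abs_reDW_one_le_mul_abs_apply)
open Summit.QuantumFields.BalabanUV.Beta.FP.GradedIteratedDerivOn
open Summit.QuantumFields.BalabanUV.Beta.FP.MaxwellSymbolDerivOn
open Literature.MathematicalPhysics.QuantumFieldTheory.Balaban1983to89.Beta.SymbolExpansion (S1r_le_sq)

variable {d : ℕ}

/-! ## §1 The real slices of the continuum multiplier are `C³` on the open interval and their derivatives are `reDW` -/

/-- [folklore] zone points have sup norm `≤ π`. -/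
theorem norm_le_pi_of_mem_BZ {s : Fin (d + 1) → ℝ} (hs : s ∈ BZ (d + 1)) : ‖s‖ ≤ Real.pi :=
  (pi_norm_le_iff_of_nonneg Real.pi_pos.le).mpr fun a => by rw [Real.norm_eq_abs]; exact abs_le.mpr ⟨hs.1 a, hs.2 a⟩

/-- [folklore] the coordinate of a zone point lies in the open interval `(−(π+δ), π+δ)`. -/
theorem apply_mem_Ioo {s : Fin (d + 1) → ℝ} (hs : s ∈ BZ (d + 1)) (i : Fin (d + 1)) :
    s i ∈ Ioo (-(Real.pi + delta166 (d + 1))) (Real.pi + delta166 (d + 1)) := by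
  have hδ := delta166_pos (d + 1)
  exact ⟨by linarith [hs.1 i], by linarith [hs.2 i]⟩

/-- [folklore] membership in the open interval as an absolute-value bound. -/
theorem abs_lt_of_mem_Ioo {δ : ℝ} {t : ℝ} (ht : t ∈ Ioo (-(Real.pi + δ)) (Real.pi + δ)) : |t| < Real.pi + δ := abs_lt.mpr ⟨ht.1, ht.2⟩

/-- [folklore] each member of the `reDW` chain is differentiable, hence `C⁰`, on the open interval. -/
theorem differentiableOn_reDW_slice (j : ℕ) (μ ν i : Fin (d + 1)) {s : Fin (d + 1) → ℝ} (hs : s ∈ BZ (d + 1)) :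
    DifferentiableOn ℝ (fun u : ℝ => reDW j μ ν i (Function.update s i u)) (Ioo (-(Real.pi + delta166 (d + 1))) (Real.pi + delta166 (d + 1))) :=
  fun _ ht => (hasDerivAt_reDW_update j μ ν i hs (abs_lt_of_mem_Ioo ht)).differentiableAt.differentiableWithinAt

/-- [folklore] on the open interval `deriv (reDW j-slice) = reDW (j+1)-slice`. -/
theorem deriv_reDW_slice_eqOn (j : ℕ) (μ ν i : Fin (d + 1)) {s : Fin (d + 1) → ℝ} (hs : s ∈ BZ (d + 1)) :
    EqOn (deriv (fun u : ℝ => reDW j μ ν i (Function.update s i u))) (fun u : ℝ => reDW (j + 1) μ ν i (Function.update s i u))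
      (Ioo (-(Real.pi + delta166 (d + 1))) (Real.pi + delta166 (d + 1))) :=
  fun _ ht => (hasDerivAt_reDW_update j μ ν i hs (abs_lt_of_mem_Ioo ht)).deriv

/-- [folklore] **THE REAL SLICE OF `W_∞` IS `C³` ON THE OPEN INTERVAL** (indeed `Cᵏ` for every `k`; three applications of `contDiffOn_succ_iff_deriv_of_isOpen`). -/
theorem contDiffOn_reDW_slice (μ ν i : Fin (d + 1)) {s : Fin (d + 1) → ℝ} (hs : s ∈ BZ (d + 1)) :
    ContDiffOn ℝ 3 (fun u : ℝ => reDW 0 μ ν i (Function.update s i u)) (Ioo (-(Real.pi + delta166 (d + 1))) (Real.pi + delta166 (d + 1))) := by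
  have hU : IsOpen (Ioo (-(Real.pi + delta166 (d + 1))) (Real.pi + delta166 (d + 1))) := isOpen_Ioo
  -- level 0 for the third derivative
  have h3 : ContDiffOn ℝ 0 (fun u : ℝ => reDW 3 μ ν i (Function.update s i u)) (Ioo (-(Real.pi + delta166 (d + 1))) (Real.pi + delta166 (d + 1))) :=
    contDiffOn_zero.mpr (differentiableOn_reDW_slice 3 μ ν i hs).continuousOn
  have step : ∀ (j : ℕ) (n : ℕ), ContDiffOn ℝ (n : WithTop ℕ∞) (fun u : ℝ => reDW (j + 1) μ ν i (Function.update s i u))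
      (Ioo (-(Real.pi + delta166 (d + 1))) (Real.pi + delta166 (d + 1))) →
      ContDiffOn ℝ ((n : WithTop ℕ∞) + 1) (fun u : ℝ => reDW j μ ν i (Function.update s i u))
        (Ioo (-(Real.pi + delta166 (d + 1))) (Real.pi + delta166 (d + 1))) := by
    intro j n h
    refine (contDiffOn_succ_iff_deriv_of_isOpen hU).mpr ⟨differentiableOn_reDW_slice j μ ν i hs, ?_, ?_⟩
    · intro hω; exact absurd hω (by exact_mod_cast WithTop.natCast_ne_top n)
    · exact h.congr fun t ht => deriv_reDW_slice_eqOn j μ ν i hs ht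
  have h2 := step 2 0 (by exact_mod_cast h3)
  have h1 := step 1 1 (by exact_mod_cast h2)
  have h0 := step 0 2 (by exact_mod_cast h1)
  exact_mod_cast h0

/-- [folklore] the complex cast of the real slice is `ContDiffOn ℝ 3` on the open interval. -/
theorem contDiffOn_reW_slice (μ ν i : Fin (d + 1)) {s : Fin (d + 1) → ℝ} (hs : s ∈ BZ (d + 1)) :
    ContDiffOn ℝ 3 (fun u : ℝ => (((W166Inf μ ν (ofRealVec (Function.update s i u))).re : ℝ) : ℂ))
      (Ioo (-(Real.pi + delta166 (d + 1))) (Real.pi + delta166 (d + 1))) := by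
  have h := Complex.ofRealCLM.contDiff.comp_contDiffOn (contDiffOn_reDW_slice μ ν i hs)
  refine h.congr fun u _ => ?_
  simp [reDW_zero]

/-- [folklore] the complex-cast chain: `HasDerivAt (u ↦ ((reDW j ⋯ (update s i u) : ℝ) : ℂ)) ((reDW (j+1) ⋯ (update s i t) : ℝ) : ℂ) t` on the open interval. -/
theorem hasDerivAt_ofReal_reDW_slice (j : ℕ) (μ ν i : Fin (d + 1)) {s : Fin (d + 1) → ℝ} (hs : s ∈ BZ (d + 1)) {t : ℝ}
    (ht : t ∈ Ioo (-(Real.pi + delta166 (d + 1))) (Real.pi + delta166 (d + 1))) :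
    HasDerivAt (fun u : ℝ => ((reDW j μ ν i (Function.update s i u) : ℝ) : ℂ)) ((reDW (j + 1) μ ν i (Function.update s i t) : ℝ) : ℂ) t :=
  (hasDerivAt_reDW_update j μ ν i hs (abs_lt_of_mem_Ioo ht)).ofReal_comp

/-- [folklore] **THE REAL-PARAMETER DERIVATIVES OF THE CAST SLICE ARE `reDW`**: for `t` in the open interval and `n ≤ 3`,
`iteratedDeriv n (u ↦ ((reDW 0 ⋯ (update s i u) : ℝ) : ℂ)) t = ((reDW n ⋯ (update s i t) : ℝ) : ℂ)` (uniqueness of derivatives near `t`). -/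
theorem iteratedDeriv_ofReal_reDW_slice (μ ν i : Fin (d + 1)) {s : Fin (d + 1) → ℝ} (hs : s ∈ BZ (d + 1)) :
    ∀ n ≤ 3, ∀ t ∈ Ioo (-(Real.pi + delta166 (d + 1))) (Real.pi + delta166 (d + 1)),
      iteratedDeriv n (fun u : ℝ => ((reDW 0 μ ν i (Function.update s i u) : ℝ) : ℂ)) t = ((reDW n μ ν i (Function.update s i t) : ℝ) : ℂ) := by
  have hU : IsOpen (Ioo (-(Real.pi + delta166 (d + 1))) (Real.pi + delta166 (d + 1))) := isOpen_Ioo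
  -- generic step: the (k+1)-st iterated derivative of the `reDW j` cast slice is the k-th of the `reDW (j+1)` cast slice, at points of U
  have step : ∀ (k j : ℕ), ∀ t ∈ Ioo (-(Real.pi + delta166 (d + 1))) (Real.pi + delta166 (d + 1)),
      iteratedDeriv (k + 1) (fun u : ℝ => ((reDW j μ ν i (Function.update s i u) : ℝ) : ℂ)) t
        = iteratedDeriv k (fun u : ℝ => ((reDW (j + 1) μ ν i (Function.update s i u) : ℝ) : ℂ)) t := by
    intro k j t ht
    rw [iteratedDeriv_succ']
    refine Filter.EventuallyEq.iteratedDeriv_eq k ?_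
    filter_upwards [hU.mem_nhds ht] with u hu
    exact (hasDerivAt_ofReal_reDW_slice j μ ν i hs hu).deriv
  intro n hn t ht
  interval_cases n
  · simp
  · rw [step 0 0 t ht]; simp
  · rw [step 1 0 t ht, step 0 1 t ht]; simp
  · rw [step 2 0 t ht, step 1 1 t ht, step 0 2 t ht]; simp

/-! ## §2 The graded weight hypothesis for `Re W_∞`, discharged -/

/-- [our object] THE GRADED CONSTANT OF THE PERFECT WEIGHT: `cwP d := CW (d+1)·(d+1) + 2B∕(δ∕2)² + 2B∕(δ∕2)² + 6B∕(δ∕2)³` (`B = bound166 (d+1)`, `δ = delta166 (d+1)`;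
non-explicit through the Cauchy constants of W166-HOLO). -/
def cwP (d : ℕ) : ℝ :=
  CW (d + 1) * ((d : ℝ) + 1) + 2 * bound166 (d + 1) / (delta166 (d + 1) / 2) ^ 2 + 2 * bound166 (d + 1) / (delta166 (d + 1) / 2) ^ 2
    + 6 * bound166 (d + 1) / (delta166 (d + 1) / 2) ^ 3

/-- [folklore] `0 ≤ cwP d`. -/
theorem cwP_nonneg (d : ℕ) : 0 ≤ cwP d := by
  unfold cwP
  have h1 := CW_nonneg (d + 1); have h2 := bound166_nonneg (d + 1); have h3 := delta166_pos (d + 1)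
  positivity

/-- [folklore] `Σ_a S1r (s a) ≤ (d+1)·‖s‖²` (chord `S1r t ≤ t²` and `|s a| ≤ ‖s‖`). -/
theorem sum_S1r_le_mul_norm_sq (s : Fin (d + 1) → ℝ) : ∑ a, S1r (s a) ≤ ((d : ℝ) + 1) * ‖s‖ ^ 2 := by
  calc ∑ a, S1r (s a) ≤ ∑ _a : Fin (d + 1), ‖s‖ ^ 2 := Finset.sum_le_sum fun a _ => (S1r_le_sq (s a)).trans (by
          have h := norm_le_pi_norm s a
          rw [Real.norm_eq_abs] at h
          rw [← sq_abs]; exact pow_le_pow_left₀ (abs_nonneg _) h 2)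
    _ = ((d : ℝ) + 1) * ‖s‖ ^ 2 := by simp

/-- [our object] **THE GRADED WEIGHT HYPOTHESIS OF R1′, DISCHARGED FOR `Re W_∞`**: for `s ∈ BZ (d+1)` and every `μ ν i`,
`‖iteratedDeriv n (u ↦ ((Re W_∞(μ,ν; update s i u) : ℝ) : ℂ) − 1) (s i)‖ ≤ cwP d · ‖s‖^{2−n}` for `n ≤ 3`. -/
theorem graded_reW_slice (μ ν i : Fin (d + 1)) {s : Fin (d + 1) → ℝ} (hs : s ∈ BZ (d + 1)) :
    ∀ n ≤ 3, ‖iteratedDeriv n (fun u : ℝ => (((W166Inf μ ν (ofRealVec (Function.update s i u))).re : ℝ) : ℂ) - 1) (s i)‖ ≤ cwP d * ‖s‖ ^ (2 - n) := by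
  have hB := bound166_nonneg (d + 1); have hδ := delta166_pos (d + 1); have hCW := CW_nonneg (d + 1)
  have hsi := apply_mem_Ioo hs i
  -- rewrite the weight as `reDW 0`
  have ew : (fun u : ℝ => (((W166Inf μ ν (ofRealVec (Function.update s i u))).re : ℝ) : ℂ) - 1)
      = fun u : ℝ => ((reDW 0 μ ν i (Function.update s i u) : ℝ) : ℂ) - 1 := by
    funext u; rw [reDW_zero]
  rw [ew]
  -- nonnegative pieces of `cwP`
  set c0 : ℝ := CW (d + 1) * ((d : ℝ) + 1) with hc0
  set c1 : ℝ := 2 * bound166 (d + 1) / (delta166 (d + 1) / 2) ^ 2 with hc1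
  set c2 : ℝ := 2 * bound166 (d + 1) / (delta166 (d + 1) / 2) ^ 2 with hc2
  set c3 : ℝ := 6 * bound166 (d + 1) / (delta166 (d + 1) / 2) ^ 3 with hc3
  have h0c : 0 ≤ c0 := by positivity
  have h1c : 0 ≤ c1 := by positivity
  have h2c : 0 ≤ c2 := by positivity
  have h3c : 0 ≤ c3 := by positivity
  have ecw : cwP d = c0 + c1 + c2 + c3 := rfl
  -- derivatives of order ≥ 1 of `slice − 1` are those of the slice
  have hsub : ∀ k : ℕ, iteratedDeriv (k + 1) (fun u : ℝ => ((reDW 0 μ ν i (Function.update s i u) : ℝ) : ℂ) - 1)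
      = iteratedDeriv (k + 1) (fun u : ℝ => ((reDW 0 μ ν i (Function.update s i u) : ℝ) : ℂ)) := by
    intro k
    rw [iteratedDeriv_succ', iteratedDeriv_succ']
    congr 1
    funext x
    exact deriv_sub_const 1
  have hsi' : |s i| ≤ ‖s‖ := by have h := norm_le_pi_norm s i; rwa [Real.norm_eq_abs] at h
  intro n hn
  interval_cases n
  · -- order 0: W166-FLAT
    rw [iteratedDeriv_zero, Function.update_eq_self, reDW_zero, ← Complex.ofReal_one, ← Complex.ofReal_sub, Complex.norm_real, Real.norm_eq_abs]
    calc |(W166Inf μ ν (ofRealVec s)).re - 1| ≤ CW (d + 1) * ∑ a, S1r (s a) := abs_re_W166Inf_ofReal_sub_one_le μ ν hs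
      _ ≤ CW (d + 1) * (((d : ℝ) + 1) * ‖s‖ ^ 2) := mul_le_mul_of_nonneg_left (sum_S1r_le_mul_norm_sq s) hCW
      _ = c0 * ‖s‖ ^ (2 - 0) := by rw [hc0]; ring
      _ ≤ cwP d * ‖s‖ ^ (2 - 0) := mul_le_mul_of_nonneg_right (by rw [ecw]; linarith) (pow_nonneg (norm_nonneg _) _)
  · -- order 1: evenness + Cauchy (W166-HOLO)
    rw [hsub 0, iteratedDeriv_ofReal_reDW_slice μ ν i hs 1 (by norm_num) (s i) hsi, Function.update_eq_self, Complex.norm_real,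
      Real.norm_eq_abs]
    calc |reDW 1 μ ν i s| ≤ c1 * |s i| := abs_reDW_one_le_mul_abs_apply μ ν i hs
      _ ≤ c1 * ‖s‖ := mul_le_mul_of_nonneg_left hsi' h1c
      _ ≤ cwP d * ‖s‖ ^ (2 - 1) := by
          rw [show (2 - 1 : ℕ) = 1 from rfl, pow_one]
          exact mul_le_mul_of_nonneg_right (by rw [ecw]; linarith) (norm_nonneg _)
  · -- order 2: Cauchy
    rw [hsub 1, iteratedDeriv_ofReal_reDW_slice μ ν i hs 2 (by norm_num) (s i) hsi, Function.update_eq_self, Complex.norm_real,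
      Real.norm_eq_abs]
    calc |reDW 2 μ ν i s| ≤ (2 : ℕ).factorial * bound166 (d + 1) / (delta166 (d + 1) / 2) ^ 2 := abs_reDW_le 2 μ ν i hs
      _ = c2 := by rw [hc2]; norm_num [Nat.factorial]
      _ ≤ cwP d * ‖s‖ ^ (2 - 2) := by rw [show (2 - 2 : ℕ) = 0 from rfl, pow_zero, mul_one, ecw]; linarith
  · -- order 3: Cauchy
    rw [hsub 2, iteratedDeriv_ofReal_reDW_slice μ ν i hs 3 (by norm_num) (s i) hsi, Function.update_eq_self, Complex.norm_real,
      Real.norm_eq_abs]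
    calc |reDW 3 μ ν i s| ≤ (3 : ℕ).factorial * bound166 (d + 1) / (delta166 (d + 1) / 2) ^ 3 := abs_reDW_le 3 μ ν i hs
      _ = c3 := by rw [hc3]; norm_num [Nat.factorial]
      _ ≤ cwP d * ‖s‖ ^ (2 - 3) := by rw [show (2 - 3 : ℕ) = 0 from rfl, pow_zero, mul_one, ecw]; linarith

/-! ## §3 The perfect symbol: excess of ORDER 4, Feynman completion of ORDER 2 -/

/-- [our object] `KRP d := 128·(d+1)²·(π+1)⁶·cwP d` — the order-4 constant of the perfect excess entry. -/
def KRP (d : ℕ) : ℝ := 128 * ((d : ℝ) + 1) ^ 2 * (Real.pi + 1) ^ 6 * cwP d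

/-- [our object] `KAP d := 128·(d+1)²·(π+1)⁴·((π+1)²·cwP d + 1) + 8(π+1)²` — the order-2 constant of the perfect Feynman entry. -/
def KAP (d : ℕ) : ℝ := 128 * ((d : ℝ) + 1) ^ 2 * (Real.pi + 1) ^ 4 * ((Real.pi + 1) ^ 2 * cwP d + 1) + 8 * (Real.pi + 1) ^ 2

/-- [our object] **THE EXCESS PERFECT MAXWELL ENTRY ALONG A SLICE IS `C³` ON THE OPEN INTERVAL.** -/
theorem contDiffOn_perfect_excess_entry {s : Fin (d + 1) → ℝ} (hs : s ∈ BZ (d + 1)) (i γ β : Fin (d + 1)) :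
    ContDiffOn ℝ 3 (fun t : ℝ => maxwellMat (fun μ ν => (W166Inf μ ν (ofRealVec (Function.update s i t))).re - 1)
      (d1Sym (Function.update s i t)) γ β) (Ioo (-(Real.pi + delta166 (d + 1))) (Real.pi + delta166 (d + 1))) :=
  contDiffOn_excess_entry (fun μ ν s => (W166Inf μ ν (ofRealVec s)).re) s i (fun μ ν => contDiffOn_reW_slice μ ν i hs) γ β

/-- [our object] **THE PERFECT FEYNMAN ENTRY ALONG A SLICE IS `C³` ON THE OPEN INTERVAL.** -/
theorem contDiffOn_perfect_feyn_entry {s : Fin (d + 1) → ℝ} (hs : s ∈ BZ (d + 1)) (i γ β : Fin (d + 1)) :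
    ContDiffOn ℝ 3 (fun t : ℝ => feynMat (fun μ ν => (W166Inf μ ν (ofRealVec (Function.update s i t))).re)
      (d1Sym (Function.update s i t)) γ β) (Ioo (-(Real.pi + delta166 (d + 1))) (Real.pi + delta166 (d + 1))) :=
  contDiffOn_feyn_entry (fun μ ν s => (W166Inf μ ν (ofRealVec s)).re) s i (fun μ ν => contDiffOn_reW_slice μ ν i hs) γ β

/-- [our object] **THE EXCESS PERFECT MAXWELL ENTRY IS GRADED OF ORDER 4**: for every `s ∈ BZ (d+1)` and `i γ β`,
`‖∂ᵢⁿ [maxwellMat (Re W_∞ − 1) (p̂)]_{γβ} (s)‖ ≤ KRP d · ‖s‖^{4−n}`, `n ≤ 3` — the `R`-letters of H2-P-B. -/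
theorem graded_perfect_excess_entry {s : Fin (d + 1) → ℝ} (hs : s ∈ BZ (d + 1)) (i γ β : Fin (d + 1)) :
    ∀ n ≤ 3, ‖iteratedDeriv n (fun t : ℝ => maxwellMat (fun μ ν => (W166Inf μ ν (ofRealVec (Function.update s i t))).re - 1)
      (d1Sym (Function.update s i t)) γ β) (s i)‖ ≤ KRP d * ‖s‖ ^ (4 - n) := by
  have hM : (1 : ℝ) ≤ Real.pi + 1 := by linarith [Real.pi_pos]
  have hsM : ‖s‖ ≤ Real.pi + 1 := (norm_le_pi_of_mem_BZ hs).trans (by linarith)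
  have h := graded_excess_entry_on (fun μ ν s => (W166Inf μ ν (ofRealVec s)).re) s i isOpen_Ioo (apply_mem_Ioo hs i)
    (fun μ ν => contDiffOn_reW_slice μ ν i hs) (cwP_nonneg d) (fun μ ν => graded_reW_slice μ ν i hs) hsM hM γ β
  intro n hn
  refine (h n hn).trans (le_of_eq ?_)
  unfold KRP; push_cast; ring

/-- [our object] **THE PERFECT FEYNMAN ENTRY IS GRADED OF ORDER 2**: for every `s ∈ BZ (d+1)` and `i γ β`,
`‖∂ᵢⁿ [feynMat (Re W_∞) (p̂)]_{γβ} (s)‖ ≤ KAP d · ‖s‖^{2−n}`, `n ≤ 3` — the `A`-letters of H2-P-INV for the matrix inverted by `PinfSym`. -/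
theorem graded_perfect_feyn_entry {s : Fin (d + 1) → ℝ} (hs : s ∈ BZ (d + 1)) (i γ β : Fin (d + 1)) :
    ∀ n ≤ 3, ‖iteratedDeriv n (fun t : ℝ => feynMat (fun μ ν => (W166Inf μ ν (ofRealVec (Function.update s i t))).re)
      (d1Sym (Function.update s i t)) γ β) (s i)‖ ≤ KAP d * ‖s‖ ^ (2 - n) := by
  have hM : (1 : ℝ) ≤ Real.pi + 1 := by linarith [Real.pi_pos]
  have hsM : ‖s‖ ≤ Real.pi + 1 := (norm_le_pi_of_mem_BZ hs).trans (by linarith)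
  have h := graded_feyn_entry_on (fun μ ν s => (W166Inf μ ν (ofRealVec s)).re) s i isOpen_Ioo (apply_mem_Ioo hs i)
    (fun μ ν => contDiffOn_reW_slice μ ν i hs) (cwP_nonneg d) (fun μ ν => graded_reW_slice μ ν i hs) hsM hM γ β
  intro n hn
  refine (h n hn).trans (le_of_eq ?_)
  unfold KAP; push_cast; ring

/-- [our object] **THE CHAIN FOR THE EXCESS ENTRY** on the open interval (the `hder` links of `PuncturedCoordDeriv` for `R`). -/
theorem hasDerivAt_perfect_excess_chain {s : Fin (d + 1) → ℝ} (hs : s ∈ BZ (d + 1)) (i γ β : Fin (d + 1)) {j : ℕ} (hj : j < 3)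
    {t : ℝ} (ht : t ∈ Ioo (-(Real.pi + delta166 (d + 1))) (Real.pi + delta166 (d + 1))) :
    HasDerivAt (iteratedDeriv j (fun u : ℝ => maxwellMat (fun μ ν => (W166Inf μ ν (ofRealVec (Function.update s i u))).re - 1)
        (d1Sym (Function.update s i u)) γ β))
      (iteratedDeriv (j + 1) (fun u : ℝ => maxwellMat (fun μ ν => (W166Inf μ ν (ofRealVec (Function.update s i u))).re - 1)
        (d1Sym (Function.update s i u)) γ β) t) t :=
  hasDerivAt_iteratedDeriv_on isOpen_Ioo (contDiffOn_perfect_excess_entry hs i γ β) hj ht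

/-- [our object] **THE CHAIN FOR THE FEYNMAN ENTRY** on the open interval (the `A_j` links of H2-P-INV). -/
theorem hasDerivAt_perfect_feyn_chain {s : Fin (d + 1) → ℝ} (hs : s ∈ BZ (d + 1)) (i γ β : Fin (d + 1)) {j : ℕ} (hj : j < 3)
    {t : ℝ} (ht : t ∈ Ioo (-(Real.pi + delta166 (d + 1))) (Real.pi + delta166 (d + 1))) :
    HasDerivAt (iteratedDeriv j (fun u : ℝ => feynMat (fun μ ν => (W166Inf μ ν (ofRealVec (Function.update s i u))).re)
        (d1Sym (Function.update s i u)) γ β))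
      (iteratedDeriv (j + 1) (fun u : ℝ => feynMat (fun μ ν => (W166Inf μ ν (ofRealVec (Function.update s i u))).re)
        (d1Sym (Function.update s i u)) γ β) t) t :=
  hasDerivAt_iteratedDeriv_on isOpen_Ioo (contDiffOn_perfect_feyn_entry hs i γ β) hj ht

end Summit.QuantumFields.BalabanUV.Beta.FP.PerfectSymbolDeriv

end
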